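import Mathlib.NumberTheory.Harmonic.ZetaAsymp
import Mathlib.NumberTheory.LSeries.DirichletContinuation
import Mathlib.Analysis.SpecialFunctions.Pow.Deriv
import Mathlib.Data.Nat.Totient
import HarnessLib

/-!
# Diamond–Ford generalized Euler constants: the constant term of `ζ(s) Π_{p∈P}(1 − p^{−s})` at `s = 1`

Topic `Literature/NumberTheory/LFunctions`. Proofs only (no definitions, no named facts).

H. G. Diamond and K. Ford, *Generalized Euler constants*, Math. Proc. Cambridge Philos. Soc. 145
(2008) 27–41 [DiamondFord2008], §1: for a finite set of primes `P`, with `δ_P = Π_{p∈P}(1 − 1/p)`,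
the generalized Euler constant `γ(P) := lim_{x→∞} (Σ_{n≤x, (n,Πp)=1} 1/n − δ_P log x)` «is the
constant term in the Laurent series about 1 of the Dirichlet series
`Σ 1_P(n) n^{−s} = ζ(s) Π_{p∈P}(1 − p^{−s})` … That is,
`γ(P) = lim_{s→1} { ζ(s) Π_{p∈P}(1 − p^{−s}) − δ_P/(s−1) }`», and «**Proposition 1.** Let `P` be any
finite set of primes. Then `γ(P) = Π_{p∈P}(1 − 1/p) · { γ + Σ_{p∈P} log p/(p − 1) }`.» (also
Lagarias, Bull. AMS 50 (2013) §3.8).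

Here, in the constant-term representation: **`tendsto_riemannZeta_mul_prod_sub_div`** —
`ζ(s) Π_{p∈P}(1 − p^{−s}) − δ_P/(s−1) → δ_P (γ + Σ_{p∈P} log p/(p−1))` as `s → 1`, `s ≠ 1` (for any
finite set `P` of naturals `> 1`; Mathlib's `tendsto_riemannZeta_sub_one_div` for `ζ(s) − 1/(s−1) → γ`
and the derivative of the Euler factor product, `hasDerivAt_prod_one_sub_cpow_neg`), and for
`P = ` the prime factors of `N` — `ζ(s) Π_{p∣N}(1 − p^{−s}) = L(s, χ₀ mod N)` (Mathlib's
`DirichletCharacter.LFunctionTrivChar_eq_mul_riemannZeta`) — **the constant term of the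
`L`-function of the principal character**: `L(s,χ₀) − (φ(N)/N)/(s−1) → (φ(N)/N)(γ + Σ_{p∣N} log p/(p−1))`
(`tendsto_LFunctionTrivChar_sub_div`, `tendsto_LFunctionTrivChar_sub_totient_div`).

Cell pub-zeta5 (HONEST FRAMING: systematic search; no irrationality claim unless certified):
textbook/printed identities made kernel theorems; nothing here concerns `ζ(5)`.
-/

noncomputable section

open Complex Finset Filter Topology

namespace Literature.NumberTheory.LFunctions

namespace DiamondFord

/-! ### The Euler-factor product `E_P(s) = Π_{p∈P}(1 − p^{−s})` -/

/-- `d/ds (1 − p^{−s}) = p^{−s} log p` (`p ≠ 0`). [folklore] -/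
private theorem hasDerivAt_one_sub_cpow_neg {p : ℕ} (hp : p ≠ 0) (s : ℂ) :
    HasDerivAt (fun z : ℂ => 1 - (p : ℂ) ^ (-z)) ((p : ℂ) ^ (-s) * Complex.log p) s := by
  have h := ((hasDerivAt_neg' (x := s)).const_cpow (c := (p : ℂ)) (Or.inl (by exact_mod_cast hp))).const_sub 1
  refine h.congr_deriv ?_
  rw [mul_neg_one, neg_neg]

/-- **The derivative of the Euler-factor product**: for a finite set `P` of non-zero naturals,
`d/ds Π_{p∈P}(1 − p^{−s}) = Σ_{p∈P} (Π_{q∈P, q≠p}(1 − q^{−s})) · p^{−s} log p`.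
[cite: DiamondFord2008, §1 («a small Abelian argument shows that it is the constant term …»)] -/
theorem hasDerivAt_prod_one_sub_cpow_neg (P : Finset ℕ) (hP : ∀ p ∈ P, p ≠ 0) (s : ℂ) :
    HasDerivAt (fun z : ℂ => ∏ p ∈ P, (1 - (p : ℂ) ^ (-z)))
      (∑ p ∈ P, (∏ q ∈ P.erase p, (1 - (q : ℂ) ^ (-s))) * ((p : ℂ) ^ (-s) * Complex.log p)) s := by
  classical
  have h := HasDerivAt.fun_finsetProd (u := P) (x := s)
    (f := fun p (z : ℂ) => 1 - (p : ℂ) ^ (-z))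
    (f' := fun p => (p : ℂ) ^ (-s) * Complex.log p)
    (fun p hp => hasDerivAt_one_sub_cpow_neg (hP p hp) s)
  simpa only [smul_eq_mul] using h

/-- The value at `s = 1`: `Π_{p∈P}(1 − p^{−1}) = δ_P`. [folklore] -/
private theorem prod_one_sub_cpow_neg_one (P : Finset ℕ) :
    ∏ p ∈ P, (1 - (p : ℂ) ^ (-(1 : ℂ))) = ∏ p ∈ P, (1 - (p : ℂ)⁻¹) :=
  Finset.prod_congr rfl fun p _ => by rw [cpow_neg_one]

/-- The derivative at `s = 1` in closed form:
`Σ_{p∈P} (Π_{q≠p}(1 − 1/q)) · (log p)/p = δ_P · Σ_{p∈P} log p/(p − 1)` (`p > 1`).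
[cite: DiamondFord2008, Proposition 1 (proof: `−Σ_{d∣P} μ(d) log d/d = δ_P Σ_p log p/(p−1)`)] -/
theorem sum_prod_erase_mul_eq (P : Finset ℕ) (hP : ∀ p ∈ P, 1 < p) :
    ∑ p ∈ P, (∏ q ∈ P.erase p, (1 - (q : ℂ)⁻¹)) * ((p : ℂ)⁻¹ * Complex.log p) =
      (∏ p ∈ P, (1 - (p : ℂ)⁻¹)) * ∑ p ∈ P, Complex.log p / ((p : ℂ) - 1) := by
  classical
  rw [Finset.mul_sum]
  refine Finset.sum_congr rfl fun p hp => ?_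
  have hp1 := hP p hp
  have hpC : (p : ℂ) ≠ 0 := by exact_mod_cast (show p ≠ 0 by omega)
  have hp1C : (p : ℂ) - 1 ≠ 0 := by
    have : (1 : ℂ) ≠ p := by exact_mod_cast (show (1 : ℕ) ≠ p by omega)
    exact sub_ne_zero.2 this.symm
  have hfac : (1 : ℂ) - (p : ℂ)⁻¹ ≠ 0 := by
    rw [sub_ne_zero, ne_comm]
    exact fun h => hp1C (by rw [inv_eq_one] at h; rw [h, sub_self])
  rw [← Finset.mul_prod_erase P (fun q => 1 - (q : ℂ)⁻¹) hp]
  field_simp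

/-! ### The constant term -/

/-- **Diamond–Ford 2008, §1 and Proposition 1 (constant-term form).** For a finite set `P` of
naturals `> 1` (in the source: primes), with `δ_P = Π_{p∈P}(1 − 1/p)`:
`ζ(s) Π_{p∈P}(1 − p^{−s}) − δ_P/(s − 1) → δ_P · (γ + Σ_{p∈P} log p/(p − 1))` as `s → 1`, `s ≠ 1` —
the generalized Euler constant `γ(P)`, «the constant term in the Laurent series about 1 of
`ζ(s)Π_{p∈P}(1 − p^{−s})`», equals `Π_{p∈P}(1 − 1/p){γ + Σ_{p∈P} log p/(p−1)}`. Proof: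
`ζE − E(1)/(s−1) = (ζ − 1/(s−1))E + (E − E(1))/(s−1)` with Mathlib's `ζ(s) − 1/(s−1) → γ` and the
derivative of `E` at `1`. [cite: DiamondFord2008, Proposition 1] -/
theorem tendsto_riemannZeta_mul_prod_sub_div (P : Finset ℕ) (hP : ∀ p ∈ P, 1 < p) :
    Tendsto (fun s : ℂ => riemannZeta s * ∏ p ∈ P, (1 - (p : ℂ) ^ (-s)) -
        (∏ p ∈ P, (1 - (p : ℂ)⁻¹)) / (s - 1)) (𝓝[≠] 1)
      (𝓝 ((∏ p ∈ P, (1 - (p : ℂ)⁻¹)) *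
        (Real.eulerMascheroniConstant + ∑ p ∈ P, Complex.log p / ((p : ℂ) - 1)))) := by
  classical
  set E : ℂ → ℂ := fun z => ∏ p ∈ P, (1 - (p : ℂ) ^ (-z)) with hE
  have hP0 : ∀ p ∈ P, p ≠ 0 := fun p hp => by have := hP p hp; omega
  have hE1 : E 1 = ∏ p ∈ P, (1 - (p : ℂ)⁻¹) := prod_one_sub_cpow_neg_one P
  -- the derivative of `E` at `1`
  have hD := hasDerivAt_prod_one_sub_cpow_neg P hP0 1
  have hD1 : ∑ p ∈ P, (∏ q ∈ P.erase p, (1 - (q : ℂ) ^ (-(1 : ℂ)))) * ((p : ℂ) ^ (-(1 : ℂ)) * Complex.log p) =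
      (∏ p ∈ P, (1 - (p : ℂ)⁻¹)) * ∑ p ∈ P, Complex.log p / ((p : ℂ) - 1) := by
    rw [← sum_prod_erase_mul_eq P hP]
    refine Finset.sum_congr rfl fun p _ => ?_
    rw [cpow_neg_one, Finset.prod_congr rfl fun q _ => by rw [cpow_neg_one]]
  rw [hD1] at hD
  -- `(E(s) − E(1))/(s − 1) → E'(1)`
  have hslope : Tendsto (fun s : ℂ => (E s - E 1) / (s - 1)) (𝓝[≠] 1)
      (𝓝 ((∏ p ∈ P, (1 - (p : ℂ)⁻¹)) * ∑ p ∈ P, Complex.log p / ((p : ℂ) - 1))) := by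
    have h := hD.tendsto_slope
    rw [show slope E 1 = fun s => (E s - E 1) / (s - 1) from funext fun s => slope_def_field E 1 s] at h
    exact h
  -- `(ζ(s) − 1/(s−1)) E(s) → γ E(1)`
  have hEc : Tendsto E (𝓝[≠] 1) (𝓝 (E 1)) :=
    tendsto_nhdsWithin_of_tendsto_nhds hD.continuousAt.tendsto
  have hζ := tendsto_riemannZeta_sub_one_div.mul hEc
  have hsum := hζ.add hslope
  rw [hE1] at hsum
  refine (hsum.congr' ?_).trans ?_
  · filter_upwards [self_mem_nhdsWithin] with s hs
    have hs1 : s - 1 ≠ 0 := sub_ne_zero.2 hs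
    simp only [hE]
    field_simp
    ring
  · rw [mul_add, mul_comm (Real.eulerMascheroniConstant : ℂ)]

/-! ### The principal character: `L(s, χ₀ mod N) = ζ(s) Π_{p∣N}(1 − p^{−s})` -/

/-- **The constant term of `L(s, χ₀)` for the principal character mod `N`**:
`L(s, χ₀) − (Π_{p∣N}(1 − 1/p))/(s − 1) → (Π_{p∣N}(1 − 1/p)) · (γ + Σ_{p∣N} log p/(p − 1))`
(`s → 1`, `s ≠ 1`) — Diamond–Ford's `γ(P)` at `P = ` the prime divisors of `N`, through Mathlib's
`LFunctionTrivChar_eq_mul_riemannZeta`. [cite: DiamondFord2008, Proposition 1] -/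
theorem tendsto_LFunctionTrivChar_sub_div (N : ℕ) [NeZero N] :
    Tendsto (fun s : ℂ => DirichletCharacter.LFunctionTrivChar N s -
        (∏ p ∈ N.primeFactors, (1 - (p : ℂ)⁻¹)) / (s - 1)) (𝓝[≠] 1)
      (𝓝 ((∏ p ∈ N.primeFactors, (1 - (p : ℂ)⁻¹)) *
        (Real.eulerMascheroniConstant + ∑ p ∈ N.primeFactors, Complex.log p / ((p : ℂ) - 1)))) := by
  have h := tendsto_riemannZeta_mul_prod_sub_div N.primeFactors
    fun p hp => (Nat.prime_of_mem_primeFactors hp).one_lt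
  refine h.congr' ?_
  filter_upwards [self_mem_nhdsWithin] with s hs
  rw [DirichletCharacter.LFunctionTrivChar_eq_mul_riemannZeta hs, mul_comm]

/-- `Π_{p∣N}(1 − 1/p) = φ(N)/N` (Euler's product for the totient), in `ℂ`. [folklore] -/
private theorem prod_primeFactors_eq_totient_div (N : ℕ) [NeZero N] :
    ∏ p ∈ N.primeFactors, (1 - (p : ℂ)⁻¹) = (Nat.totient N : ℂ) / N := by
  have hN : (N : ℂ) ≠ 0 := by exact_mod_cast NeZero.ne N
  have h := congrArg (fun x : ℚ => (x : ℂ)) (Nat.totient_eq_mul_prod_factors N)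
  push_cast at h
  rw [eq_div_iff hN, mul_comm, ← h]

/-- **The constant term of `L(s, χ₀ mod N)` with the residue `φ(N)/N`**:
`L(s, χ₀) − (φ(N)/N)/(s − 1) → (φ(N)/N)(γ + Σ_{p∣N} log p/(p − 1))` (`s → 1`, `s ≠ 1`).
[cite: DiamondFord2008, Proposition 1] -/
theorem tendsto_LFunctionTrivChar_sub_totient_div (N : ℕ) [NeZero N] :
    Tendsto (fun s : ℂ => DirichletCharacter.LFunctionTrivChar N s -
        ((Nat.totient N : ℂ) / N) / (s - 1)) (𝓝[≠] 1)
      (𝓝 (((Nat.totient N : ℂ) / N) *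
        (Real.eulerMascheroniConstant + ∑ p ∈ N.primeFactors, Complex.log p / ((p : ℂ) - 1)))) := by
  rw [← prod_primeFactors_eq_totient_div]
  exact tendsto_LFunctionTrivChar_sub_div N

end DiamondFord

end Literature.NumberTheory.LFunctions
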